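import Summits.AtomisticToContinuum.BoseEinsteinCondensation.Theses.BECLaplacianL1
import Literature.MathematicalPhysics.QuantumManyBody.BoseGasClusterStates
import Literature.MathematicalPhysics.QuantumManyBody.JelliumBoseGasCondensateDilation

/-!
# Route `BECLaplacianL1`, support item `DiluteEnergyBound` (stmt-AtomisticToContinuum-9011)

The crude dilute energy bound along the thermodynamic box sequence `L_N = (N/ρ)^{1/3}`:
for every repulsive finite-range pair potential `v` (hard cores allowed) there are `C, ρ₀ > 0`
with `E₀^per(N, L_N) ≤ C ρ^{2/3} N` for `0 < ρ < ρ₀` and all large `N`.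

Proof (entirely from results already proved in the tree; no scattering length, no Dyson bound):

* Ruelle's subadditivity bound `limsup_energyPerParticle_le` [Ruelle1969, §3.5.11] with two
  one-particle cells of side `ℓ`: if `2σ(ℓ + R)³ < 2` then
  `limsup_N E₀^D(N, L_N(σ))/N ≤ (E₀^D(1, ℓ) + E₀^D(1, ℓ))/2 = E₀^D(1, ℓ)` — a single particle has no
  pair interaction, hard cores included (`interaction_one`);
* dilation covariance `groundStateEnergy_dilate` [LSSY2005, Ch. 5, footnote to (5.3)] and the
  potential-independence of the one-particle energy give the scaling
  `E₀^D(1, ℓ) = ℓ⁻² E₀^D(1, 1)`, with `E₀^D(1, 1) < ∞` (`groundStateEnergy_one_lt_top`);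
* periodic at density `ρ` ≤ Dirichlet at density `2ρ` eventually
  (`IsRepulsiveFiniteRange.eventually_energyPerParticlePeriodic_le`, periodising Dirichlet states
  with range padding, [LSSY2005, Ch. 2, after (2.2)]).

With `R = max R₀ 1`, `ρ₀ = 1/(64 R³)`, `t = ρ^{1/3}`, `ℓ = 1/(4t)` (so `R ≤ ℓ` and
`4ρ(ℓ + R)³ ≤ 1/2 < 2`) and `b = E₀^D(1,1)`: `limsup_N E₀^D(N, L_N(2ρ))/N ≤ 16 t² b < (16 b + 1) t²`,
hence eventually `E₀^per(N, L_N(ρ)) ≤ E₀^D(N, L_N(2ρ)) ≤ (16 b + 1) ρ^{2/3} N`; `C = 16 b + 1`.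

References: D. Ruelle, *Statistical Mechanics: Rigorous Results* (1969), §3.5.11;
E. H. Lieb, R. Seiringer, J. P. Solovej, J. Yngvason, *The Mathematics of the Bose Gas and its
Condensation* (2005), Ch. 2 (after (2.2)) and Ch. 5.
-/

noncomputable section

namespace Summit.AtomisticToContinuum.BoseEinsteinCondensation.Theorems

open Filter
open scoped ENNReal
open Literature.MathematicalPhysics.QuantumManyBody.BoseGas

/-- For one particle the energy of a trial state does not depend on the pair potential
(the interaction of a single particle is an empty sum). [folklore] -/
theorem energy_one_eq_energy (w w' : ℝ → ℝ≥0∞) {L : ℝ} (Ψ : TrialState 1 L) :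
    energy w Ψ = energy w' Ψ := by
  simp only [energy, interaction_one]

/-- For one particle the Dirichlet ground-state energy does not depend on the pair potential.
[folklore] -/
theorem groundStateEnergy_one_eq_groundStateEnergy (w w' : ℝ → ℝ≥0∞) (L : ℝ) :
    groundStateEnergy w 1 L = groundStateEnergy w' 1 L :=
  iInf_congr fun Ψ => energy_one_eq_energy w w' Ψ

/-- **Scaling of the one-particle box energy**: `E₀^D(1, s) = s⁻² E₀^D(1, 1)` for `s > 0`
(dilation covariance of the ground-state energy; the scaled potential is irrelevant for a single
particle). [folklore] -/
theorem groundStateEnergy_one_eq_scale (v : ℝ → ℝ≥0∞) {s : ℝ} (hs : 0 < s) :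
    groundStateEnergy v 1 s = ENNReal.ofReal (s ^ 2)⁻¹ * groundStateEnergy v 1 1 := by
  rw [groundStateEnergy_one_eq_groundStateEnergy v (scalePotential s v) s,
    ← Literature.MathematicalPhysics.QuantumManyBody.JelliumBoseGas.groundStateEnergy_dilate v 1 1 hs,
    mul_one]

/-- **`DiluteEnergyBound` holds** (settles stmt-AtomisticToContinuum-9011, exact route decl):
for every repulsive finite-range `v` there are `C > 0` and `ρ₀ > 0` such that for `0 < ρ < ρ₀`,
eventually in `N`, `periodicGroundStateEnergy v N (sideLength ρ N) ≤ ofReal (C ρ^{2/3} N)`.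
Ruelle subadditivity with one-particle cells at Dirichlet density `2ρ`, one-particle scaling,
and periodic ≤ Dirichlet at the double density. [cite: Ruelle1969, §3.5.11] -/
theorem diluteEnergyBound_proof :
    Summit.AtomisticToContinuum.BoseEinsteinCondensation.Theses.BECLaplacianL1.DiluteEnergyBound := by
  unfold Summit.AtomisticToContinuum.BoseEinsteinCondensation.Theses.BECLaplacianL1.DiluteEnergyBound
  intro v hv
  obtain ⟨R₀, hR₀⟩ := hv.2
  -- a positive range `R ≥ R₀`
  set R : ℝ := max R₀ 1 with hR_def
  have hR1 : 1 ≤ R := le_max_right _ _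
  have hR : 0 < R := lt_of_lt_of_le one_pos hR1
  have hv0 : ∀ r, R < r → v r = 0 := fun r hr => hR₀ r (lt_of_le_of_lt (le_max_left _ _) hr)
  -- the one-particle unit-box constant
  set B : ℝ≥0∞ := groundStateEnergy v 1 1 with hB_def
  have hBtop : B ≠ ⊤ := (groundStateEnergy_one_lt_top v one_pos).ne
  set b : ℝ := B.toReal with hb_def
  have hb0 : 0 ≤ b := ENNReal.toReal_nonneg
  have hBb : B = ENNReal.ofReal b := (ENNReal.ofReal_toReal hBtop).symm
  refine ⟨16 * b + 1, by positivity, 1 / (64 * R ^ 3), by positivity, fun ρ hρ hρ₀ => ?_⟩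
  -- the scales `t = ρ^{1/3}`, `ℓ = 1/(4t)`
  set t : ℝ := ρ ^ ((1 : ℝ) / 3) with ht_def
  have ht : 0 < t := Real.rpow_pos_of_pos hρ _
  have ht3 : t ^ 3 = ρ := by
    rw [ht_def, show ((1 : ℝ) / 3) = ((3 : ℕ) : ℝ)⁻¹ by norm_num,
      Real.rpow_inv_natCast_pow hρ.le three_ne_zero]
  have ht2 : ρ ^ ((2 : ℝ) / 3) = t ^ 2 := by
    rw [ht_def, ← Real.rpow_natCast, ← Real.rpow_mul hρ.le]
    norm_num
  set ℓ : ℝ := 1 / (4 * t) with hℓ_def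
  have hℓ : 0 < ℓ := by positivity
  have hℓt : ℓ * t = 1 / 4 := by
    rw [hℓ_def]
    field_simp
  -- `R ≤ ℓ`, from `ρ < 1/(64 R³)`
  have htR : t < 1 / (4 * R) := by
    refine lt_of_pow_lt_pow_left₀ 3 (by positivity) ?_
    rw [ht3]
    calc ρ < 1 / (64 * R ^ 3) := hρ₀
      _ = (1 / (4 * R)) ^ 3 := by rw [div_pow]; ring
  have hRℓ : R ≤ ℓ := by
    rw [hℓ_def, le_div_iff₀ (by positivity)]
    rw [lt_div_iff₀ (by positivity)] at htR
    nlinarith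
  -- the two one-particle cells fit at density `2ρ`
  have hσ : 0 < 2 * ρ := by positivity
  have hfit : 2 * (2 * ρ) * (ℓ + R) ^ 3 < ((1 + 1 : ℕ) : ℝ) := by
    have hℓR : ℓ + R ≤ 2 * ℓ := by linarith
    have h3 : (ℓ + R) ^ 3 ≤ (2 * ℓ) ^ 3 := pow_le_pow_left₀ (by positivity) hℓR 3
    calc 2 * (2 * ρ) * (ℓ + R) ^ 3 ≤ 2 * (2 * ρ) * (2 * ℓ) ^ 3 := by gcongr
      _ = 32 * (ℓ * t) ^ 3 := by rw [← ht3]; ring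
      _ < ((1 + 1 : ℕ) : ℝ) := by rw [hℓt]; norm_num
  -- Ruelle's bound with `n₁ = n₂ = 1`
  have hlimsup : limsup (energyPerParticleDirichlet v (2 * ρ)) atTop ≤ groundStateEnergy v 1 ℓ := by
    have h := limsup_energyPerParticle_le (n₁ := 1) (n₂ := 1) hv.1 hv0 hR hσ hℓ hfit
    have h2 : (groundStateEnergy v 1 ℓ + groundStateEnergy v 1 ℓ) / ((1 + 1 : ℕ) : ℝ≥0∞) =
        groundStateEnergy v 1 ℓ := by
      rw [ENNReal.add_div, show ((1 + 1 : ℕ) : ℝ≥0∞) = 2 by norm_num, ENNReal.add_halves]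
    rwa [h2] at h
  -- one-particle scaling: `E₀^D(1, ℓ) = 16 t² b < (16 b + 1) t²`
  set K : ℝ≥0∞ := ENNReal.ofReal ((16 * b + 1) * t ^ 2) with hK_def
  have hℓ2 : (ℓ ^ 2)⁻¹ = 16 * t ^ 2 := by
    rw [hℓ_def]
    field_simp
    ring
  have hE1 : groundStateEnergy v 1 ℓ < K := by
    rw [groundStateEnergy_one_eq_scale v hℓ, hℓ2, ← hB_def, hBb,
      ← ENNReal.ofReal_mul (by positivity), hK_def, ENNReal.ofReal_lt_ofReal_iff (by positivity)]
    nlinarith [sq_nonneg t, ht]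
  have hev₁ : ∀ᶠ N : ℕ in atTop, energyPerParticleDirichlet v (2 * ρ) N < K :=
    Filter.eventually_lt_of_limsup_lt (hlimsup.trans_lt hE1)
  have hev₂ : ∀ᶠ N : ℕ in atTop,
      energyPerParticlePeriodic v ρ N ≤ energyPerParticleDirichlet v (2 * ρ) N :=
    hv.eventually_energyPerParticlePeriodic_le hρ (by linarith)
  filter_upwards [hev₁, hev₂, eventually_gt_atTop 0] with N h₁ h₂ hN0
  have h₃ : periodicGroundStateEnergy v N (sideLength ρ N) / N < K := h₂.trans_lt h₁
  have hN0' : (N : ℝ≥0∞) ≠ 0 := by exact_mod_cast hN0.ne'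
  have h₄ := (ENNReal.div_lt_iff (Or.inl hN0') (Or.inl (ENNReal.natCast_ne_top N))).1 h₃
  refine h₄.le.trans (le_of_eq ?_)
  rw [hK_def, ht2, ← ENNReal.ofReal_natCast, ← ENNReal.ofReal_mul (by positivity)]

end Summit.AtomisticToContinuum.BoseEinsteinCondensation.Theorems

end
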